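import Summits.CriticalPhenomena.PercolationContinuityZ3.Theorems.PercNearOneGluingNoHeavyQuantThreeClusterFibreCount
import HarnessLib

/-!
# The multi-depth fibre system: every depth class of `TN` injects into `E` (balls round `a` are read off the image)

builds on p205010 (kernel theorem, internal audit signed; external expert review pending)

Support file (`--supports stmt-CriticalPhenomena-4575`), seat `prim-quant-p1` (gen 43); memo
`run/shared/lean/prim/quant/prim-quant-p1-g43/FOR-LEAD-Z32-FIBRES.md` §2.  No definitions, no named facts, no sorries;
standard axioms.

The rooted fibre map of ✓ p621518 / ✓ p621867 (`Z := C₁ on T(A) ∪ J, C₂ elsewhere`) with the root region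
`A = B_k(C₁)` = the `C₁`-ball of radius `k` round `a` (`B_0 = {a}`, `B_{j+1} = B_j ∪ N_{C₁}(B_j)`): then `N = B_{k+1}`, the
reachability hypothesis of `classCount_fibre_le` is automatic (`ball_reachable`), and — the point of this file — THE BALLS ARE
READ OFF THE IMAGE (`ball_eq_of_agree`: `Z` and `C₁` agree on the edges touching `B_k`, so their balls agree up to radius `k+1`).
Hence for each fixed `k` the map is injective on the whole depth class `d = k+1`:
* `classCount_fibre_depth_le (k)` — in every class `I ⊆ U`: `#{T : b ↮ c in C₂, B_{k+1}(C₁) misses C_b(C₂) ∪ C_c(C₂), some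
  C₁-edge from B_{k+1}(C₁) enters C_b(C₂)} ≤ #{T : I ∪ T ∈ ab|c}`;
* `classCount_TN_depth_le_E (k)` — **the depth-`(k+1)` part of `TN` is at most `E` in every class** (with the depth-0 count of
  ✓ p621867 this is "`TN_d ≤ E` for every `d`": the multi-depth fibre system of the p1 g42 memo §7 is injective depth by depth;
  different depths can share partners — at most one per pair of fibres, memo §2.3 — which is why `TN ≤ 3E` does not follow).
Balls are passed as a function `ball : ℕ → Set V` with its two defining equations (no definition is introduced; the counting
theorems instantiate it with `Nat.rec`).
-/

namespace Summit.CriticalPhenomena.PercolationContinuityZ3.Theorems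

open Finset Literature.Probability.Percolation Literature.Probability.Percolation.DecisionTree

variable {V : Type*}

namespace ThreeClusterSwap

section Ball

variable (C₁ : Set (Sym2 V)) (a : V) (ball : ℕ → Set V)

/-- `a` lies in every ball. [this work] -/
theorem mem_ball_self (h0 : ball 0 = {a})
    (hS : ∀ j, ball (j + 1) = ball j ∪ {w | ∃ u ∈ ball j, s(u, w) ∈ C₁ ∧ u ≠ w}) (j : ℕ) : a ∈ ball j := by
  induction j with
  | zero => rw [h0]; exact Set.mem_singleton a
  | succ j ih => rw [hS]; exact Or.inl ih

/-- Balls increase. [this work] -/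
theorem ball_subset_succ (hS : ∀ j, ball (j + 1) = ball j ∪ {w | ∃ u ∈ ball j, s(u, w) ∈ C₁ ∧ u ≠ w}) (j : ℕ) :
    ball j ⊆ ball (j + 1) := by
  intro v hv; rw [hS]; exact Or.inl hv

/-- Balls increase (general). [this work] -/
theorem ball_mono (hS : ∀ j, ball (j + 1) = ball j ∪ {w | ∃ u ∈ ball j, s(u, w) ∈ C₁ ∧ u ≠ w}) {i j : ℕ} (hij : i ≤ j) :
    ball i ⊆ ball j := by
  induction hij with
  | refl => exact le_rfl
  | step _ ih => exact ih.trans (ball_subset_succ C₁ ball hS _)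

/-- The closed neighbourhood form of the next ball: `{a} ∪ B_k ∪ N_{C₁}(B_k) = B_{k+1}`. [this work] -/
theorem ball_succ_eq_N (h0 : ball 0 = {a})
    (hS : ∀ j, ball (j + 1) = ball j ∪ {w | ∃ u ∈ ball j, s(u, w) ∈ C₁ ∧ u ≠ w}) (k : ℕ) :
    {v | v = a ∨ v ∈ ball k ∨ ∃ u ∈ ball k, s(u, v) ∈ C₁ ∧ u ≠ v} = ball (k + 1) := by
  ext v
  rw [hS]
  simp only [Set.mem_setOf_eq, Set.mem_union]
  constructor
  · rintro (rfl | h | h)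
    · exact Or.inl (mem_ball_self C₁ _ ball h0 hS k)
    · exact Or.inl h
    · exact Or.inr h
  · rintro (h | h)
    · exact Or.inr (Or.inl h)
    · exact Or.inr (Or.inr h)

/-- Every vertex of `B_k` is `C₁`-reachable from `a` through edges touching `B_k`. [this work] -/
theorem ball_reachable (h0 : ball 0 = {a})
    (hS : ∀ j, ball (j + 1) = ball j ∪ {w | ∃ u ∈ ball j, s(u, w) ∈ C₁ ∧ u ≠ w}) (k : ℕ) :
    ∀ v ∈ ball k, (openGraph (C₁ ∩ {e | ∃ u ∈ ball k, u ∈ e})).Reachable a v := by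
  -- induction on the radius `j ≤ k`, with the target graph fixed at radius `k`
  suffices h : ∀ j, j ≤ k → ∀ v ∈ ball j, (openGraph (C₁ ∩ {e | ∃ u ∈ ball k, u ∈ e})).Reachable a v from h k le_rfl
  intro j
  induction j with
  | zero =>
    intro _ v hv
    rw [h0] at hv
    rw [Set.mem_singleton_iff.1 hv]
  | succ j ih =>
    intro hjk v hv
    rw [hS] at hv
    rcases hv with hv | ⟨u, hu, huv, hne⟩
    · exact ih (Nat.le_of_succ_le hjk) v hv
    · have hu' : (openGraph (C₁ ∩ {e | ∃ u ∈ ball k, u ∈ e})).Reachable a u := ih (Nat.le_of_succ_le hjk) u hu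
      have huk : u ∈ ball k := ball_mono C₁ ball hS (Nat.le_of_succ_le hjk) hu
      have he : s(u, v) ∈ C₁ ∩ {e | ∃ u ∈ ball k, u ∈ e} := ⟨huv, u, huk, Sym2.mem_mk_left u v⟩
      exact hu'.trans ((openGraph_adj _ u v).2 ⟨he, hne⟩).reachable

/-- **The balls are read off the image.**  If `Z` and `C₁` agree on every edge touching `B_k(C₁)`, then the balls of `Z` and of
`C₁` round `a` coincide up to radius `k + 1`. [this work] -/
theorem ball_eq_of_agree (Z : Set (Sym2 V)) (ball' : ℕ → Set V) (h0 : ball 0 = {a})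
    (hS : ∀ j, ball (j + 1) = ball j ∪ {w | ∃ u ∈ ball j, s(u, w) ∈ C₁ ∧ u ≠ w}) (h0' : ball' 0 = {a})
    (hS' : ∀ j, ball' (j + 1) = ball' j ∪ {w | ∃ u ∈ ball' j, s(u, w) ∈ Z ∧ u ≠ w}) (k : ℕ)
    (hagree : ∀ u ∈ ball k, ∀ w, (s(u, w) ∈ Z ↔ s(u, w) ∈ C₁)) :
    ∀ j, j ≤ k + 1 → ball' j = ball j := by
  intro j
  induction j with
  | zero => intro _; rw [h0, h0']
  | succ j ih =>
    intro hj
    have hjk : j ≤ k := Nat.le_of_lt_succ hj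
    have e := ih (Nat.le_of_succ_le hj)
    rw [hS, hS', e]
    ext w
    simp only [Set.mem_union, Set.mem_setOf_eq]
    constructor
    · rintro (h | ⟨u, hu, huw, hne⟩)
      · exact Or.inl h
      · exact Or.inr ⟨u, hu, (hagree u (ball_mono C₁ ball hS hjk hu) w).1 huw, hne⟩
    · rintro (h | ⟨u, hu, huw, hne⟩)
      · exact Or.inl h
      · exact Or.inr ⟨u, hu, (hagree u (ball_mono C₁ ball hS hjk hu) w).2 huw, hne⟩

end Ball

/-! ### Counting: each depth class injects into `ab|c` -/

section Count

variable [Fintype V] [DecidableEq V]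

open scoped Classical

/-- **Depth `k+1`, towards `b`.**  In every class (`C₁ = I ∪ T`, `C₂ = I ∪ (F ∖ T)`), with `B_j` the `C₁`-balls round `a`:
the number of `T` with `b ↮ c` in `C₂`, no vertex of `B_{k+1}` `C₂`-joined to `b` or to `c`, and some `C₁`-open edge from
`B_{k+1}` into `C_b(C₂)`, is at most `#{T : I ∪ T ∈ ab|c}`.  (The rooted fibre map with `A = B_k`; injective on the whole depth
class because `B_k` is read off the image, `ball_eq_of_agree`.) [this work] -/
theorem classCount_fibre_depth_le (I F : Finset (Sym2 V)) (a b c : V) (k : ℕ) :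
    ((F.powerset.filter fun T =>
        ¬ (openGraph (↑(I ∪ (F \ T)) : Set (Sym2 V))).Reachable b c ∧
        (∀ v ∈ (Nat.rec (motive := fun _ => Set V) ({a} : Set V)
            (fun _ B => B ∪ {w | ∃ u ∈ B, s(u, w) ∈ (↑(I ∪ T) : Set (Sym2 V)) ∧ u ≠ w}) (k + 1) : Set V),
          ¬ (openGraph (↑(I ∪ (F \ T)) : Set (Sym2 V))).Reachable b v ∧
          ¬ (openGraph (↑(I ∪ (F \ T)) : Set (Sym2 V))).Reachable c v) ∧
        (∃ e ∈ (↑(I ∪ T) : Set (Sym2 V)),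
          ∃ u ∈ (Nat.rec (motive := fun _ => Set V) ({a} : Set V)
            (fun _ B => B ∪ {w | ∃ u ∈ B, s(u, w) ∈ (↑(I ∪ T) : Set (Sym2 V)) ∧ u ≠ w}) (k + 1) : Set V),
          ∃ s ∈ ({v | (openGraph (↑(I ∪ (F \ T)) : Set (Sym2 V))).Reachable b v} : Set V), e = s(u, s))).card) ≤
    (F.powerset.filter fun T =>
        (openGraph (↑(I ∪ T) : Set (Sym2 V))).Reachable a b ∧
          ¬ (openGraph (↑(I ∪ T) : Set (Sym2 V))).Reachable a c).card := by
  -- data of the map, as functions of `T`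
  let X : Finset (Sym2 V) → Set (Sym2 V) := fun T => (↑(I ∪ T) : Set (Sym2 V))
  let Xb : Finset (Sym2 V) → Set (Sym2 V) := fun T => (↑(I ∪ (F \ T)) : Set (Sym2 V))
  let ball : Finset (Sym2 V) → ℕ → Set V := fun T =>
    fun j => Nat.rec (motive := fun _ => Set V) ({a} : Set V) (fun _ B => B ∪ {w | ∃ u ∈ B, s(u, w) ∈ X T ∧ u ≠ w}) j
  have hb0 : ∀ T, ball T 0 = {a} := fun T => rfl
  have hbS : ∀ T j, ball T (j + 1) = ball T j ∪ {w | ∃ u ∈ ball T j, s(u, w) ∈ X T ∧ u ≠ w} := fun T j => rfl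
  let A : Finset (Sym2 V) → Set V := fun T => ball T k
  let N : Finset (Sym2 V) → Set V := fun T => {v | v = a ∨ v ∈ A T ∨ ∃ u ∈ A T, s(u, v) ∈ X T ∧ u ≠ v}
  have hN : ∀ T, N T = ball T (k + 1) := fun T => ball_succ_eq_N (X T) a (ball T) (hb0 T) (hbS T) k
  let S : Finset (Sym2 V) → Set V := fun T => {v | (openGraph (Xb T)).Reachable b v}
  let TA : Finset (Sym2 V) → Set (Sym2 V) := fun T => {e | ∃ v ∈ A T, v ∈ e}
  let J : Finset (Sym2 V) → Set (Sym2 V) := fun T => {e | e ∈ X T ∧ ∃ u ∈ N T, ∃ s ∈ S T, e = s(u, s)}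
  let W : Finset (Sym2 V) → Set (Sym2 V) := fun T => TA T ∪ J T
  let G : Finset (Sym2 V) → Finset (Sym2 V) := fun T => F.filter fun e => e ∈ (W T)ᶜ
  let f : Finset (Sym2 V) → Finset (Sym2 V) := fun T => (T \ G T) ∪ ((F \ T) ∩ G T)
  have hG : ∀ T e, e ∈ G T ↔ e ∈ F ∧ e ∈ (W T)ᶜ := fun T e => Finset.mem_filter
  have hcoe : ∀ T ⊆ F, (↑(I ∪ f T) : Set (Sym2 V)) = (X T ∩ W T) ∪ (Xb T \ W T) := by
    intro T hT
    rw [coe_union_flipOn I F T (G T) (W T)ᶜ hT (hG T)]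
    ext e
    simp only [Set.mem_union, Set.mem_inter_iff, Set.mem_sdiff, Set.mem_compl_iff, X, Xb]
    tauto
  -- on the image, edges touching `B_k` keep their `C₁`-values
  have hagree : ∀ T, ∀ u ∈ ball T k, ∀ w, (s(u, w) ∈ (X T ∩ W T) ∪ (Xb T \ W T) ↔ s(u, w) ∈ X T) := by
    intro T u hu w
    exact fibre_mem_Z_iff_of_mem_W (X T) (Xb T) (W T) _ rfl
      (Or.inl ⟨u, hu, Sym2.mem_mk_left u w⟩ : s(u, w) ∈ TA T ∪ J T)
  refine Finset.card_le_card_of_injOn f (fun T hT => ?_) (fun T₁ h₁ T₂ h₂ heq => ?_)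
  · rw [Finset.mem_coe, Finset.mem_filter, Finset.mem_powerset] at hT ⊢
    obtain ⟨hTF, hbc, hNsep, hJne⟩ := hT
    change ∀ v ∈ ball T (k + 1), _ at hNsep
    change ∃ e ∈ X T, ∃ u ∈ ball T (k + 1), ∃ s ∈ S T, e = s(u, s) at hJne
    rw [← hN T] at hNsep hJne
    have hNS : ∀ v ∈ N T, v ∉ S T := fun v hv hvS => (hNsep v hv).1 hvS
    have hNSc : ∀ v ∈ N T, ¬ (openGraph (Xb T)).Reachable c v := fun v hv => (hNsep v hv).2
    have hJne' : ∃ e, e ∈ J T := by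
      obtain ⟨e, he, u, hu, s, hs, rfl⟩ := hJne
      exact ⟨s(u, s), he, u, hu, s, hs, rfl⟩
    have hconn : ∀ v ∈ A T, (openGraph (X T ∩ TA T)).Reachable a v :=
      ball_reachable (X T) a (ball T) (hb0 T) (hbS T) k
    refine ⟨flipOn_subset F (G T) T hTF, ?_, ?_⟩
    · rw [hcoe T hTF]
      exact fibre_reachable_b (X T) (Xb T) a b (A T) (N T) (S T) (TA T) (J T) (W T) _ rfl rfl rfl rfl rfl rfl hconn hNS hJne'
    · rw [hcoe T hTF]
      exact fibre_not_reachable_c (X T) (Xb T) a b c (A T) (N T) (S T) (TA T) (J T) (W T) _ rfl rfl rfl rfl rfl rfl hNSc hbc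
  · rw [Finset.coe_filter] at h₁ h₂
    have hT₁ : T₁ ⊆ F := Finset.mem_powerset.1 h₁.1
    have hT₂ : T₂ ⊆ F := Finset.mem_powerset.1 h₂.1
    have hNS₁ : ∀ v ∈ N T₁, v ∉ S T₁ := by
      intro v hv hvS; rw [hN T₁] at hv; exact (h₁.2.2.1 v hv).1 hvS
    have hNS₂ : ∀ v ∈ N T₂, v ∉ S T₂ := by
      intro v hv hvS; rw [hN T₂] at hv; exact (h₂.2.2.1 v hv).1 hvS
    -- the common image
    have hZeq : (X T₁ ∩ W T₁) ∪ (Xb T₁ \ W T₁) = (X T₂ ∩ W T₂) ∪ (Xb T₂ \ W T₂) := by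
      rw [← hcoe T₁ hT₁, ← hcoe T₂ hT₂, heq]
    -- read the balls off the image: the root regions agree
    let Zs : Set (Sym2 V) := (X T₁ ∩ W T₁) ∪ (Xb T₁ \ W T₁)
    let ballZ : ℕ → Set V := fun j => Nat.rec (motive := fun _ => Set V) ({a} : Set V) (fun _ B => B ∪ {w | ∃ u ∈ B, s(u, w) ∈ Zs ∧ u ≠ w}) j
    have e₁ : ∀ j, j ≤ k + 1 → ballZ j = ball T₁ j :=
      ball_eq_of_agree (X T₁) a (ball T₁) Zs ballZ (hb0 T₁) (hbS T₁) rfl (fun _ => rfl) k (hagree T₁)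
    have e₂ : ∀ j, j ≤ k + 1 → ballZ j = ball T₂ j :=
      ball_eq_of_agree (X T₂) a (ball T₂) Zs ballZ (hb0 T₂) (hbS T₂) rfl (fun _ => rfl) k
        (by intro u hu w; change s(u, w) ∈ (X T₁ ∩ W T₁) ∪ (Xb T₁ \ W T₁) ↔ _; rw [hZeq]; exact hagree T₂ u hu w)
    have hAeq : A T₁ = A T₂ := by
      change ball T₁ k = ball T₂ k
      rw [← e₁ k (Nat.le_succ k), e₂ k (Nat.le_succ k)]
    -- decode `N`, then `S`, then `J`, hence `W`
    have hNeq : N T₁ = N T₂ := by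
      rw [← fibre_decode_N (X T₁) (Xb T₁) a (A T₁) (N T₁) (TA T₁) (J T₁) (W T₁) _ rfl rfl rfl rfl,
        ← fibre_decode_N (X T₂) (Xb T₂) a (A T₂) (N T₂) (TA T₂) (J T₂) (W T₂) _ rfl rfl rfl rfl, hZeq, hAeq]
    have hSeq : S T₁ = S T₂ := by
      ext v
      change (openGraph (Xb T₁)).Reachable b v ↔ (openGraph (Xb T₂)).Reachable b v
      rw [← fibre_decode_S (X T₁) (Xb T₁) a b (A T₁) (N T₁) (S T₁) (TA T₁) (J T₁) (W T₁) _ rfl rfl rfl rfl rfl rfl hNS₁ v,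
        ← fibre_decode_S (X T₂) (Xb T₂) a b (A T₂) (N T₂) (S T₂) (TA T₂) (J T₂) (W T₂) _ rfl rfl rfl rfl rfl rfl hNS₂ v,
        hZeq, hNeq]
    have hJeq : J T₁ = J T₂ := by
      rw [← fibre_decode_J (X T₁) (Xb T₁) b (N T₁) (S T₁) (TA T₁) (J T₁) (W T₁) _ rfl rfl rfl rfl hNS₁,
        ← fibre_decode_J (X T₂) (Xb T₂) b (N T₂) (S T₂) (TA T₂) (J T₂) (W T₂) _ rfl rfl rfl rfl hNS₂, hZeq, hNeq, hSeq]
    have hTAeq : TA T₁ = TA T₂ := by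
      change {e | ∃ v ∈ A T₁, v ∈ e} = {e | ∃ v ∈ A T₂, v ∈ e}
      rw [hAeq]
    have hWeq : W T₁ = W T₂ := by
      change TA T₁ ∪ J T₁ = TA T₂ ∪ J T₂
      rw [hJeq, hTAeq]
    have hGeq : G T₁ = G T₂ := by
      ext e
      rw [hG, hG, hWeq]
    have e1 : T₁ = ((f T₁ \ G T₁) ∪ ((F \ f T₁) ∩ G T₁)) := (flipOn_flipOn F (G T₁) T₁ hT₁).symm
    have e2 : T₂ = ((f T₂ \ G T₂) ∪ ((F \ f T₂) ∩ G T₂)) := (flipOn_flipOn F (G T₂) T₂ hT₂).symm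
    rw [e1, e2, heq, hGeq]

/-- **Every depth class of `TN` is at most `E`, in every class.**  For `k : ℕ`, with `B_{k+1}` the `C₁`-ball of radius `k+1`
round `a`: `#{T : C₂ ∈ a|b|c, B_{k+1}(C₁) ∩ (C_b(C₂) ∪ C_c(C₂)) = ∅, some C₁-edge from B_{k+1}(C₁) enters C_b(C₂) ∪ C_c(C₂)}
≤ #{T : C₁ ∈ ab|c ∪ ac|b}` — these `T` are exactly the `TN`-configurations of depth `k+1` (distance from `a` to the
`C₂`-clusters of `b, c` equal to `k+2`), except that `C₁ ∈ abc` is not needed. [this work] -/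
theorem classCount_TN_depth_le_E (I F : Finset (Sym2 V)) (a b c : V) (k : ℕ) :
    ((F.powerset.filter fun T =>
        (¬ (openGraph (↑(I ∪ (F \ T)) : Set (Sym2 V))).Reachable a b ∧
          ¬ (openGraph (↑(I ∪ (F \ T)) : Set (Sym2 V))).Reachable a c ∧
          ¬ (openGraph (↑(I ∪ (F \ T)) : Set (Sym2 V))).Reachable b c) ∧
        (∀ v ∈ (Nat.rec (motive := fun _ => Set V) ({a} : Set V)
            (fun _ B => B ∪ {w | ∃ u ∈ B, s(u, w) ∈ (↑(I ∪ T) : Set (Sym2 V)) ∧ u ≠ w}) (k + 1) : Set V),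
          ¬ (openGraph (↑(I ∪ (F \ T)) : Set (Sym2 V))).Reachable b v ∧
          ¬ (openGraph (↑(I ∪ (F \ T)) : Set (Sym2 V))).Reachable c v) ∧
        (∃ e ∈ (↑(I ∪ T) : Set (Sym2 V)),
          ∃ u ∈ (Nat.rec (motive := fun _ => Set V) ({a} : Set V)
            (fun _ B => B ∪ {w | ∃ u ∈ B, s(u, w) ∈ (↑(I ∪ T) : Set (Sym2 V)) ∧ u ≠ w}) (k + 1) : Set V),
          ∃ s, ((openGraph (↑(I ∪ (F \ T)) : Set (Sym2 V))).Reachable b s ∨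
            (openGraph (↑(I ∪ (F \ T)) : Set (Sym2 V))).Reachable c s) ∧ e = s(u, s))).card) ≤
    (F.powerset.filter fun T =>
        ((openGraph (↑(I ∪ T) : Set (Sym2 V))).Reachable a b ∧
            ¬ (openGraph (↑(I ∪ T) : Set (Sym2 V))).Reachable a c) ∨
          ((openGraph (↑(I ∪ T) : Set (Sym2 V))).Reachable a c ∧
            ¬ (openGraph (↑(I ∪ T) : Set (Sym2 V))).Reachable a b)).card := by
  have hb := classCount_fibre_depth_le I F a b c k
  have hc := classCount_fibre_depth_le I F a c b k
  refine card_filter_le_of_cover_two hc hb (fun T h1 h2 => h1.2 h2.1) fun T _ hT => ?_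
  obtain ⟨⟨_, _, hbc⟩, hsep, e, he, u, hu, s, hs, hes⟩ := hT
  rcases hs with hs | hs
  · exact Or.inr ⟨hbc, hsep, e, he, u, hu, s, hs, hes⟩
  · exact Or.inl ⟨fun h => hbc h.symm, fun v hv => ⟨(hsep v hv).2, (hsep v hv).1⟩, e, he, u, hu, s, hs, hes⟩

end Count

end ThreeClusterSwap

end Summit.CriticalPhenomena.PercolationContinuityZ3.Theorems
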